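import Summits.BirchSwinnertonDyer.Rank1Residual.P2.ShuZhaiTwoFiftySixEquation
import Summits.BirchSwinnertonDyer.Rank1Residual.P2.ShuZhaiThirtySixReduction
import Summits.BirchSwinnertonDyer.Rank1Residual.P2.ShuZhaiThirtySixTable
import Summits.BirchSwinnertonDyer.Rank1Residual.P2.ShuZhaiOneFortyFourSlices
import Literature.NumberTheory.EllipticCurves.Rank1Residual.CornerFTwoCertificates.TwistSchema
import HarnessLib

/-!
# Cell `bsd-print-cf2` (D-0131 (2) PRINT TIER, leaf CornerF @ `p = 2`), seat ty3 — display glue for the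
# Shu–Zhai twist-family certificate records: the twist EQUATIONS are global minimal models, so
# `ord_{s=1} L = 1 ∧ BSD(·, 2)` holds BY NAME for `curveX.quadraticTwist (−pM)` ITSELF (`X = 36a1, 144a1`;
# `256c1` is p2's `ShuZhaiTwoFiftySixEquation`), and every CERTIFIED twist record is a member by name

HONEST FRAMING (cell `bsd-print-cf2`, run/shared/lean/pub/bsd-print-cf2/; verbatim): PARTITION currency
only — the leaf counts when its class theorem is in the kernel BY NAME; every imported theorem carries its
printed hypotheses verbatim. The leaf is OPEN AS A CLASS; nothing class-wide is closed here; no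
definition, no named fact. Companion of the Literature schema
`Rank1Residual/CornerFTwoCertificates/TwistSchema.lean` (ty3: the record FORMAT of the three Shu–Zhai
quadratic-twist families `shuZhai256` / `shuZhai36` / `shuZhai144` and its decidable recheck) and of the
display files `CornerFTwoCertificates/RecordsShuZhai*.lean` (the certified member lists with two-engine
numeric columns). This file says what a CERTIFIED twist record gives for its curve, in the tree's
vocabulary and BY NAME:

* §1 the `144a1` twist equation `144a1^{(−m)} : y² = x³ − 3m x² + 3m² x` is a GLOBAL MINIMAL MODEL for `m`
  square-free, odd, prime to `3` (`Δ = −2⁴·3³·m⁶`, Silverman VII.1 Rem. 1.1; clone of p3's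
  `isGloballyMinimal_twist36`, whose discriminant bound is REUSED since the two discriminants agree);
* §2 `ord_{s=1} L = 1 ∧ BSD(·,2)` FOR THE EQUATIONS `36a1^{(−pM)}` and `144a1^{(−pM)}` THEMSELVES (no model
  quantifier; `C = 1` in the provers' by-name slice theorems), binders displayed and nothing else:
  `h12 h14` (Shu–Zhai Thm 1.2 / 1.4), `hCM` (row C8), `hmod`, `hARS` (ARS06 Thm 2.6), and the base entry
  `htab : table52_row36a1` resp. `hbase : base144a1_optimal_cuspZero` — exactly the fact sets of
  `analyticRank_eq_one_and_bsdp_two_of_isShuZhaiThirtySixTwist` (p3) /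
  `analyticRank_eq_one_and_bsdp_two_of_smul_twist_curve144a1_byName` (p4); for `256c1` this is p2's
  `analyticRank_eq_one_and_bsdp_two_quadraticTwist_curve256c1` (`hbase : base256c1_optimal_cuspZero`);
* §3 from a CERTIFIED record list (`TwistCertified rs`, kernel `decide` in the display files): for every
  listed record `r` of family `shuZhai256` / `shuZhai36` / `shuZhai144`,
  `ord_{s=1} L = 1 ∧ BSD(curveX.quadraticTwist (−r.param), 2)` BY NAME — the recheck discharges the printed
  congruence hypotheses (`TwistRecord.hyps256_of_check`, `TwistRecord.hyps36_of_check`), the facts above do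
  the rest. beyond-print theorem: NO (display glue).

References: [ShuZhai2021] Thm 1.2, 1.4, 4.10, §5.2 Table; [SilvermanAEC2009] VII.1 Rem 1.1, X.5 Cor 5.4;
[Cremona1997] Table 1 (36A1, 144A1, 256C1); [AgasheRibetStein2006] Thm 2.6; [BurungaleFlach2024] Cor 2;
[Miller2011LMS] Def 1.1.
-/

noncomputable section

open scoped Classical

open WeierstrassCurve NumberField Literature.NumberTheory.EllipticCurves
  Literature.NumberTheory.EllipticCurves.Rank1Residual
  Literature.NumberTheory.EllipticCurves.ModularForms
  Literature.NumberTheory.EllipticCurves.ShuZhai2021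
  Literature.NumberTheory.EllipticCurves.Rank1Residual.X11RankOneCertificates
  Literature.NumberTheory.EllipticCurves.Rank1Residual.CornerFTwoCertificates
  Summit.BirchSwinnertonDyer.Rank1Residual

set_option autoImplicit false

namespace Summit.BirchSwinnertonDyer.Rank1Residual.P2

/-! ## §1 The `144a1` twist equation is a global minimal model -/

/-- **The twist `E^{(−m)}` of `E = curve144a1` is `y² = x³ − 3m x² + 3m² x`** with INTEGER coefficients
(`b₂(E) = 12`, `b₄(E) = 6`, `b₆(E) = 0`; ty2's `quadraticTwist_curve144a1` at `D = −m`).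
[cite: SilvermanAEC2009, X.5 Cor. 5.4] -/
theorem quadraticTwist_curve144a1_neg (m : ℕ) :
    curve144a1.quadraticTwist (-(m : ℚ)) =
      (⟨((0 : ℤ) : ℚ), ((-(3 * m) : ℤ) : ℚ), ((0 : ℤ) : ℚ), ((3 * m ^ 2 : ℤ) : ℚ), ((0 : ℤ) : ℚ)⟩ :
        WeierstrassCurve ℚ) := by
  rw [quadraticTwist_curve144a1]
  ext <;> push_cast <;> ring

/-- `Δ(144a1^{(−m)}) = Δ(36a1^{(−m)})` (`= −432·m⁶`) in the tree's integer recheck `discOf`: the sign of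
`a₂` does not enter `Δ`. [folklore] -/
theorem discOf_twist144 (m : ℕ) :
    discOf [0, -(3 * (m : ℤ)), 0, 3 * (m : ℤ) ^ 2, 0] = discOf [0, 3 * (m : ℤ), 0, 3 * (m : ℤ) ^ 2, 0] := by
  simp only [discOf, invariants]
  ring

/-- **`144a1^{(−m)}` is a globally minimal integer model** for `m` square-free, odd, prime to `3`
(Silverman's criterion `ord_ℓ Δ < 12` at every prime, via p3's `not_pow_twelve_dvd_disc_twist36` — the same
discriminant). [cite: SilvermanAEC2009, VII.1 Remark 1.1 and VIII.8] -/
theorem isGloballyMinimal_twist144 {m : ℕ} (hsq : Squarefree m) (hodd : ¬ 2 ∣ m) (h3 : ¬ 3 ∣ m) :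
    (curve144a1.quadraticTwist (-(m : ℚ))).IsGloballyMinimal := by
  rw [quadraticTwist_curve144a1_neg]
  have h := isGloballyMinimal_of_int_criterion 0 (-(3 * m)) 0 (3 * m ^ 2) 0 (fun ℓ hℓ hand =>
    not_pow_twelve_dvd_disc_twist36 hsq hodd h3 hℓ (by
      rw [← discOf_twist144]
      exact_mod_cast hand.1))
  exact_mod_cast h

/-! ## §2 `ord_{s=1} L = 1 ∧ BSD(·, 2)` for the twist equations `36a1^{(−pM)}`, `144a1^{(−pM)}` themselves -/

/-- The family parameter `p·∏q` is nonzero. [folklore] -/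
theorem mul_prod_ne_zero_of_prime' {p : ℕ} (hp : p.Prime) {Q : Finset ℕ} {P : ℕ → Prop}
    (hQ : ∀ q ∈ Q, q.Prime ∧ P q) : p * ∏ q ∈ Q, q ≠ 0 :=
  Nat.pos_iff_ne_zero.mp (Nat.mul_pos hp.pos (Finset.prod_pos fun q hq => (hQ q hq).1.pos))

/-- **`ord_{s=1} L = 1 ∧ BSD(·,2)` FOR THE EQUATION `36a1^{(−pM)} : y² = x³ + 3pM x² + 3p²M² x` ITSELF**
(`p ≡ 23 (mod 24)` prime, `Q ⊂ {primes ≡ 5 (mod 12)}`, `M = ∏ q ≡ 1 (mod 24)`): the equation is a global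
minimal model (p3's `isGloballyMinimal_twist36`), so the by-name slice
`analyticRank_eq_one_and_bsdp_two_of_isShuZhaiThirtySixTwist` applies with `C = 1`. Binders displayed:
`h12 h14 hCM hmod hARS htab`. [cite: ShuZhai2021, Thm. 1.2, Thm. 1.4 and §5.2 Table (row 36a1)]
[cite: AgasheRibetStein2006, Thm. 2.6] [cite: BurungaleFlach2024, Cor. 2] [cite: Miller2011LMS, Def. 1.1] -/
theorem analyticRank_eq_one_and_bsdp_two_quadraticTwist_curve36a1 (h12 : thm12_ranks_of_twists)
    (h14 : thm14_twoPartBSD_of_twists) (hCM : bsdTriple_of_hasCM_of_L_one_ne_zero)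
    (hmod : hasEntireLFunction_rat)
    (hARS : AgasheRibetStein2006.cremona_abs_maninConstant_eq_one_of_level_le)
    (htab : table52_row36a1) {p : ℕ} (hp : p.Prime) (h24 : p % 24 = 23)
    {Q : Finset ℕ} (hQ : ∀ q ∈ Q, q.Prime ∧ q % 12 = 5) (hM : (∏ q ∈ Q, q) % 24 = 1) :
    (curve36a1.quadraticTwist (-((p * ∏ q ∈ Q, q : ℕ) : ℚ))).analyticRank = 1 ∧
      BSDp (curve36a1.quadraticTwist (-((p * ∏ q ∈ Q, q : ℕ) : ℚ))) 2 := by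
  haveI := curve36a1.isElliptic_quadraticTwist
    (neg_ne_zero.mpr (Nat.cast_ne_zero.mpr (mul_prod_ne_zero_of_prime' hp hQ)) :
      (-((p * ∏ q ∈ Q, q : ℕ) : ℚ)) ≠ 0)
  obtain ⟨hsq, hodd, h3⟩ := squarefree_odd_coprime_three_of_family hp h24 hQ
  haveI := isGloballyMinimal_twist36 hsq hodd h3
  exact analyticRank_eq_one_and_bsdp_two_of_isShuZhaiThirtySixTwist h12 h14 hCM hmod hARS htab _
    ⟨p, Q, 1, hp, h24, hQ, hM, one_smul _ _⟩

/-- **`ord_{s=1} L = 1 ∧ BSD(·,2)` FOR THE EQUATION `144a1^{(−pM)} : y² = x³ − 3pM x² + 3p²M² x` ITSELF**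
(same `(p, Q)`): the equation is a global minimal model (§1), so the by-name slice
`analyticRank_eq_one_and_bsdp_two_of_smul_twist_curve144a1_byName` applies with `C = 1`. Binders
displayed: `h12 h14 hCM hmod hARS hbase`. [cite: ShuZhai2021, Thm. 1.2 and Thm. 1.4]
[cite: Cremona1997, Table 1 (N = 144, A1) and Table 4 (144 A)] [cite: AgasheRibetStein2006, Thm. 2.6]
[cite: BurungaleFlach2024, Cor. 2] [cite: Miller2011LMS, Def. 1.1] -/
theorem analyticRank_eq_one_and_bsdp_two_quadraticTwist_curve144a1 (h12 : thm12_ranks_of_twists)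
    (h14 : thm14_twoPartBSD_of_twists) (hCM : bsdTriple_of_hasCM_of_L_one_ne_zero)
    (hmod : hasEntireLFunction_rat)
    (hARS : AgasheRibetStein2006.cremona_abs_maninConstant_eq_one_of_level_le)
    (hbase : base144a1_optimal_cuspZero) {p : ℕ} (hp : p.Prime) (h24 : p % 24 = 23)
    {Q : Finset ℕ} (hQ : ∀ q ∈ Q, q.Prime ∧ q % 12 = 5) (hM : (∏ q ∈ Q, q) % 24 = 1) :
    (curve144a1.quadraticTwist (-((p * ∏ q ∈ Q, q : ℕ) : ℚ))).analyticRank = 1 ∧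
      BSDp (curve144a1.quadraticTwist (-((p * ∏ q ∈ Q, q : ℕ) : ℚ))) 2 := by
  haveI := curve144a1.isElliptic_quadraticTwist
    (neg_ne_zero.mpr (Nat.cast_ne_zero.mpr (mul_prod_ne_zero_of_prime' hp hQ)) :
      (-((p * ∏ q ∈ Q, q : ℕ) : ℚ)) ≠ 0)
  obtain ⟨hsq, hodd, h3⟩ := squarefree_odd_coprime_three_of_family hp h24 hQ
  haveI := isGloballyMinimal_twist144 hsq hodd h3
  exact analyticRank_eq_one_and_bsdp_two_of_smul_twist_curve144a1_byName h12 h14 hCM hmod hARS hbase _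
    ⟨p, Q, 1, hp, h24, hQ, hM, one_smul _ _⟩

/-! ## §3 Every CERTIFIED twist record is a member by name -/

/-- **`shuZhai256` records**: for every record `r` of a `TwistCertified` list with
`r.family = shuZhai256`, `ord_{s=1} L = 1 ∧ BSD(256c1^{(−r.param)}, 2)` BY NAME — the recheck discharged
`p` prime, `p ≡ 7 (mod 8)`, `Q ⊂ {primes ≡ 5 (mod 8)}`, `#Q` even, `param = p·∏q`
(`TwistRecord.hyps256_of_check`); granted `h12 h14 hCM hmod hARS hbase` (p2's
`analyticRank_eq_one_and_bsdp_two_quadraticTwist_curve256c1`). [cite: ShuZhai2021, Thm. 1.2, Thm. 1.4 and Thm. 1.6 (1)]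
[cite: Cremona1997, Table 1 (256C1) and Table 4 (256C)] [cite: AgasheRibetStein2006, Thm. 2.6]
[cite: BurungaleFlach2024, Cor. 2] [cite: Miller2011LMS, Def. 1.1] -/
theorem analyticRank_eq_one_and_bsdp_two_of_twistCertified_shuZhai256 (h12 : thm12_ranks_of_twists)
    (h14 : thm14_twoPartBSD_of_twists) (hCM : bsdTriple_of_hasCM_of_L_one_ne_zero)
    (hmod : hasEntireLFunction_rat)
    (hARS : AgasheRibetStein2006.cremona_abs_maninConstant_eq_one_of_level_le)
    (hbase : base256c1_optimal_cuspZero) {rs : List TwistRecord} (h : TwistCertified rs) :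
    ∀ r ∈ rs, r.family = .shuZhai256 →
      (curve256c1.quadraticTwist (-(r.param : ℚ))).analyticRank = 1 ∧
        BSDp (curve256c1.quadraticTwist (-(r.param : ℚ))) 2 := by
  intro r hr hf
  obtain ⟨hp, h8, hQ, heven, hparam⟩ := r.hyps256_of_check (h.check_of_mem hr) hf
  have key := analyticRank_eq_one_and_bsdp_two_quadraticTwist_curve256c1 h12 h14 hCM hmod hARS hbase hp h8
    hQ heven
  rw [hparam] at key
  exact key

/-- **`shuZhai36` records**: for every record `r` of a `TwistCertified` list with `r.family = shuZhai36`,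
`ord_{s=1} L = 1 ∧ BSD(36a1^{(−r.param)}, 2)` BY NAME (recheck ⇒ `TwistRecord.hyps36_of_check`; facts
`h12 h14 hCM hmod hARS htab`). [cite: ShuZhai2021, Thm. 1.2, Thm. 1.4 and §5.2 Table (row 36a1)]
[cite: AgasheRibetStein2006, Thm. 2.6] [cite: BurungaleFlach2024, Cor. 2] [cite: Miller2011LMS, Def. 1.1] -/
theorem analyticRank_eq_one_and_bsdp_two_of_twistCertified_shuZhai36 (h12 : thm12_ranks_of_twists)
    (h14 : thm14_twoPartBSD_of_twists) (hCM : bsdTriple_of_hasCM_of_L_one_ne_zero)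
    (hmod : hasEntireLFunction_rat)
    (hARS : AgasheRibetStein2006.cremona_abs_maninConstant_eq_one_of_level_le)
    (htab : table52_row36a1) {rs : List TwistRecord} (h : TwistCertified rs) :
    ∀ r ∈ rs, r.family = .shuZhai36 →
      (curve36a1.quadraticTwist (-(r.param : ℚ))).analyticRank = 1 ∧
        BSDp (curve36a1.quadraticTwist (-(r.param : ℚ))) 2 := by
  intro r hr hf
  obtain ⟨hp, h24, hQ, hM, hparam⟩ := r.hyps36_of_check (h.check_of_mem hr) (Or.inl hf)
  have key := analyticRank_eq_one_and_bsdp_two_quadraticTwist_curve36a1 h12 h14 hCM hmod hARS htab hp h24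
    hQ hM
  rw [hparam] at key
  exact key

/-- **`shuZhai144` records**: for every record `r` of a `TwistCertified` list with `r.family = shuZhai144`,
`ord_{s=1} L = 1 ∧ BSD(144a1^{(−r.param)}, 2)` BY NAME (recheck ⇒ `TwistRecord.hyps36_of_check`; facts
`h12 h14 hCM hmod hARS hbase`). [cite: ShuZhai2021, Thm. 1.2 and Thm. 1.4]
[cite: Cremona1997, Table 1 (N = 144, A1) and Table 4 (144 A)] [cite: AgasheRibetStein2006, Thm. 2.6]
[cite: BurungaleFlach2024, Cor. 2] [cite: Miller2011LMS, Def. 1.1] -/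
theorem analyticRank_eq_one_and_bsdp_two_of_twistCertified_shuZhai144 (h12 : thm12_ranks_of_twists)
    (h14 : thm14_twoPartBSD_of_twists) (hCM : bsdTriple_of_hasCM_of_L_one_ne_zero)
    (hmod : hasEntireLFunction_rat)
    (hARS : AgasheRibetStein2006.cremona_abs_maninConstant_eq_one_of_level_le)
    (hbase : base144a1_optimal_cuspZero) {rs : List TwistRecord} (h : TwistCertified rs) :
    ∀ r ∈ rs, r.family = .shuZhai144 →
      (curve144a1.quadraticTwist (-(r.param : ℚ))).analyticRank = 1 ∧
        BSDp (curve144a1.quadraticTwist (-(r.param : ℚ))) 2 := by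
  intro r hr hf
  obtain ⟨hp, h24, hQ, hM, hparam⟩ := r.hyps36_of_check (h.check_of_mem hr) (Or.inr hf)
  have key := analyticRank_eq_one_and_bsdp_two_quadraticTwist_curve144a1 h12 h14 hCM hmod hARS hbase hp h24
    hQ hM
  rw [hparam] at key
  exact key

/-- **The a-invariants of a certified record ARE those of the curve the theorems above speak about**
(`TwistFamily.model` = the tree twist on the nose: `quadraticTwist_curve256c1`,
`quadraticTwist_curve36a1_neg`, `quadraticTwist_curve144a1_neg`), e.g. for `shuZhai256`:
`curve256c1.quadraticTwist (−n) = ⟨0, 0, 0, 2n², 0⟩`. [cite: SilvermanAEC2009, X.5 Cor. 5.4] -/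
theorem quadraticTwist_eq_of_model (n : ℕ) :
    curve256c1.quadraticTwist (-(n : ℚ)) =
        ⟨(((TwistFamily.model .shuZhai256 n)[0]?.getD 0 : ℤ) : ℚ), (((TwistFamily.model .shuZhai256 n)[1]?.getD 0 : ℤ) : ℚ),
          (((TwistFamily.model .shuZhai256 n)[2]?.getD 0 : ℤ) : ℚ), (((TwistFamily.model .shuZhai256 n)[3]?.getD 0 : ℤ) : ℚ),
          (((TwistFamily.model .shuZhai256 n)[4]?.getD 0 : ℤ) : ℚ)⟩ ∧
      curve36a1.quadraticTwist (-(n : ℚ)) =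
        ⟨(((TwistFamily.model .shuZhai36 n)[0]?.getD 0 : ℤ) : ℚ), (((TwistFamily.model .shuZhai36 n)[1]?.getD 0 : ℤ) : ℚ),
          (((TwistFamily.model .shuZhai36 n)[2]?.getD 0 : ℤ) : ℚ), (((TwistFamily.model .shuZhai36 n)[3]?.getD 0 : ℤ) : ℚ),
          (((TwistFamily.model .shuZhai36 n)[4]?.getD 0 : ℤ) : ℚ)⟩ ∧
      curve144a1.quadraticTwist (-(n : ℚ)) =
        ⟨(((TwistFamily.model .shuZhai144 n)[0]?.getD 0 : ℤ) : ℚ), (((TwistFamily.model .shuZhai144 n)[1]?.getD 0 : ℤ) : ℚ),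
          (((TwistFamily.model .shuZhai144 n)[2]?.getD 0 : ℤ) : ℚ), (((TwistFamily.model .shuZhai144 n)[3]?.getD 0 : ℤ) : ℚ),
          (((TwistFamily.model .shuZhai144 n)[4]?.getD 0 : ℤ) : ℚ)⟩ := by
  refine ⟨?_, ?_, ?_⟩
  · rw [quadraticTwist_curve256c1]; ext <;> simp [TwistFamily.model]
  · rw [quadraticTwist_curve36a1_neg]; ext <;> simp [TwistFamily.model]
  · rw [quadraticTwist_curve144a1_neg]; ext <;> simp [TwistFamily.model]

end Summit.BirchSwinnertonDyer.Rank1Residual.P2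

end
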